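import Mathlib.NumberTheory.Padics.Complex
import Mathlib.RingTheory.DiscreteValuationRing.Basic
import Mathlib.RingTheory.Valuation.ValuationSubring
import Mathlib.RingTheory.DedekindDomain.Factorization
import Literature.NumberTheory.GaloisRepresentations.NearlyOrdinaryDeformationRing
import HarnessLib

/-!
# Skinner–Wiles modelling data for a residually reducible `GL₂`-representation and the
# unique-admissible-extension regime

Topic `Literature/NumberTheory/GaloisRepresentations`; a companion of
`NearlyOrdinaryDeformationRing.lean`, whose interface `(R_𝒟, ρ_𝒟)` (a universal nearly ordinary
deformation ring of a residual datum `𝒟`, [SW, §2.1], [CM, §2]) it extends by the vocabulary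
needed to say that such a datum MODELS a given characteristic-zero representation, and to bound
the dimension of the finite-order stratum of the reducible locus of `Spec R_𝒟`:

* `fracModPrime 𝓡 𝔮` — `ρ_𝒟 mod 𝔮` over the field of fractions of the domain `R_𝒟/𝔮` (the
  representation whose reducibility defines `NearlyOrdinaryDeformationRing.reducibleLocus`,
  [SW, §2.2] "`q ⊂ R_𝒟` a prime such that `ρ_𝒟 mod q` is reducible"; see
  `mem_reducibleLocus_iff_isReducible_fracModPrime`);
* `HasFiniteOrderRatio 𝓡 𝔮` — in every upper-triangular frame of `ρ_𝒟 mod 𝔮 = (ψ₁ ∗; 0 ψ₂)`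
  over `Frac(R_𝒟/𝔮)` the ratio `ψ₁/ψ₂` of the diagonal characters
  (`Deformation.diagChar`) has finite order (vacuous off the reducible locus) — the analogue,
  for the ratio of the diagonal characters, of the finite-order conditions on the determinant in
  [SW, Lemma 2.8, Lemma 2.9 (ii)];
* `ClosedPointStratumLE 𝓡 d` — every prime `𝔮` of the reducible locus with `char (R_𝒟/𝔮) = p`
  and finite-order ratio has `dim R_𝒟/𝔮 ≤ d` (the shape of the dimension bounds
  [SW, Lemmas 2.7–2.9] for the universal reducible deformation ring and its finite-order strata,
  with the bound `d` a parameter);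
* `ModelData F p` — Skinner–Wiles coefficient and deformation data: a complete discrete
  valuation ring `𝒪` of characteristic `0` with finite residue field `k` of characteristic `p`
  ([SW, §2.1] "the ring of integers `𝒪` of a local field with finite residue field `k`"), a
  residual datum `𝒟` over `(𝒪, k)` (level `𝒟.S = Σ`, residual representation and special
  lines — the remaining entries of SW's deformation datum `(𝒪, Σ, c, ℳ)` with `ℳ = ∅`), a
  universal nearly ordinary deformation ring `𝓡` of `𝒟` and a specialisation
  `φ : R_𝒟 → ℚ̄_p`;
* `baseLevel ρ = {v ∣ p} ∪ {v : ρ ramified at v}` — the least level `Σ` at which `ρ` can be a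
  deformation of type `𝒟` ([SW, §2.1]: `Σ ⊇ Σ_p` and deformations of type `𝒟` are unramified
  outside `Σ`);
* `ModelData.Models M ρ ρ₀ S` — `M` models the pair `(ρ, ρ₀)` (`ρ : Γ_F → GL₂(ℚ̄_p)` framed,
  `ρ₀ : Γ_F → GL₂(O)` an integral model, `O` a valuation subring of `ℚ̄_p`) at level `S`:
  `ρ̄_𝒟` is upper triangular with the same ordered residual diagonal characters as `ρ₀`, has
  scalar centralizer (Mazur's representability hypothesis, [BK13, Lemma 28]: it holds for a
  non-split `(χ̄₁ ∗; 0 χ̄₂)` with `χ̄₁ ≠ χ̄₂`), is distinguished at every `v ∣ p`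
  ([CM, Def. 2.3]), is ORIENTED at every `v ∣ p` (the residual special line `(frame v) e₁` is not
  the global stable line `e₁`, so `ρ̄_𝒟|_{D_v} ≅ χ̄₁ ⊕ χ̄₂` splits and the nearly ordinary
  sub-character is residually the global QUOTIENT character — SW's condition
  "`ψ₁⁽ⁱ⁾ ≡ χ mod 𝔪_A`" for `ρ_c = (1 ∗; 0 χ)` with `c` admissible, [SW, §2.1, p. 10]),
  `𝒟.S = S`, and `φ ∘ ρ_𝒟` is `GL₂(ℚ̄_p)`-conjugate to `ρ` ("`ρ` is a deformation of type `𝒟`",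
  [SW, §2.1, p. 10]);
* `UniqueAdmissibleExtension ρ ρ₀` — THE REGIME: every `M : ModelData F p` modelling `(ρ, ρ₀)` at
  the base level has `ClosedPointStratumLE M.𝓡 2`.  Intended reading (motivation only, nothing
  of it is asserted here): by the explicit description of the universal reducible deformation
  [SW, §2.2, proof of Lemmas 2.7–2.8] the finite-order stratum of the reducible locus is governed
  by `m = dim_k H_Σ(F, k(χ⁻¹))`, the number of independent admissible residual extensions; over an
  imaginary quadratic field the bound `2` at the base level expresses `m = 1`, i.e. uniqueness of
  the admissible residual extension — the situation of [BK09, §3, Thm. 7 and its corollary]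
  (for `Σ`-admissible `χ₀` the non-split `ρ₀ = (1 ∗; 0 χ₀)` with scalar centralizer is unique up
  to isomorphism).

Provenance.  The seven declarations were first written, with these statements, as route
vocabulary in `Summits/Langlands/Langlands/Theorems/SkinnerWilesDefectOneReducibleOrdinaryProModularDefs.lean`
(namespace `Summit.Langlands.Langlands.Cruxes.ReducibleOrdinaryProModular.SteinbergHyperplane`,
§3); they are hoisted here VERBATIM (same names, binders, bodies; only the namespace moves, the
parameter `F` and the universe of `𝓡` are generalised) so that modules which cannot import that
Theorems file can share them; that file may re-export these names
(`export Literature.NumberTheory.GaloisRepresentations (ModelData …)`) in place of its copies.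

## Design

* Everything is phrased on the INTERFACE `NearlyOrdinaryDeformationRing 𝒟` (no construction is
  used); `ModelData` fixes the universe-`0` instance `NearlyOrdinaryDeformationRing.{0}` and
  `𝒪 k : Type`, so that `∀ M : ModelData F p, …` is an honest (universe-monomorphic) `Prop`.
* The nine instance fields of `ModelData` are registered as instances (`attribute [instance]`),
  so `M.𝒪`, `M.k` carry their structure silently.
* `baseLevel ρ` takes `p` implicitly from the coefficient field `PadicAlgCl p` of `ρ`.
* API: unfolding lemmas, monotonicity of `ClosedPointStratumLE` in `d`, finiteness of
  `baseLevel ρ` for an almost everywhere unramified `ρ` (`finite_baseLevel`), and the elementary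
  consequences of `Models` (`S` is finite and contains the places above `p`; `ρ̄_𝒟` is reducible).

## What is NOT here

Any dimension count or any relation between `ClosedPointStratumLE` and Selmer groups
([SW, Lemmas 2.7–2.9], [BK09, Thm. 7]) — these are theorems about CONSTRUCTED deformation rings,
not about the interface; the existence of a model for a given `(ρ, ρ₀)` (choice of a lattice, of
`E/ℚ_p` finite containing the traces, of the residual extension class); pro-modularity.

## References

* [SW] C. M. Skinner, A. J. Wiles, *Residually reducible representations and modular forms*,
  Publ. Math. IHÉS 89 (1999) 5–126: §2.1 pp. 9–10 (deformation data `(𝒪, Σ, c, ℳ)`, admissible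
  classes, deformations of type `𝒟`, `R_𝒟`), §2.2 pp. 15–17 (reducible deformations,
  Lemmas 2.7–2.9). [cite: SkinnerWiles1999, §2.1–2.2]
* [CM] F. Calegari, B. Mazur, *Nearly ordinary Galois deformations over arbitrary number
  fields*, J. Inst. Math. Jussieu 8 (2009) 99–177, §2.1 Def. 2.1–2.3. [cite: CalegariMazur2008, §2.1–2.2]
* [BK09] T. Berger, K. Klosin, *A deformation problem for Galois representations over imaginary
  quadratic fields*, J. Inst. Math. Jussieu 8 (2009) 669–692, §3 Def. 6, Thm. 7.
  [cite: BergerKlosin2009, §3 Thm. 7]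
* [BK13] T. Berger, K. Klosin, *On deformation rings of residually reducible Galois
  representations and `R = T` theorems*, Math. Ann. 355 (2013), §5.2 Lemma 28.
  [cite: BergerKlosin2012, §5.2]
-/

noncomputable section

open scoped NumberField
open Field IsDedekindDomain Matrix

namespace Literature.NumberTheory.GaloisRepresentations

universe u

/-! ### Reductions of `ρ_𝒟` modulo a prime and the finite-order stratum of the reducible locus -/

section Deformation

variable {F : Type*} [Field F] [NumberField F] {p : ℕ}
variable {𝒪 : Type*} [CommRing 𝒪] {k : Type*} [Field k] [Algebra 𝒪 k]
  {𝒟 : NearlyOrdinaryDatum F p 𝒪 k}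
variable (𝓡 : NearlyOrdinaryDeformationRing.{u} 𝒟)

/-- **`ρ_𝒟 mod 𝔮` over the field of fractions** of the domain `R_𝒟/𝔮`: the composite
`Γ_F → GL₂(R_𝒟/𝔮) → GL₂(Frac(R_𝒟/𝔮))` of `NearlyOrdinaryDeformationRing.modPrime` with the
localisation map — the representation "`ρ_𝒟 mod q`" whose reducibility ("`q ⊂ R_𝒟` a prime such
that `ρ_𝒟 mod q` is reducible") defines the reducible locus (typed exactly as in
`NearlyOrdinaryDeformationRing.reducibleLocus`). [cite: SkinnerWiles1999, §2.2] -/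
def fracModPrime (𝔮 : PrimeSpectrum 𝓡.R) :
    absoluteGaloisGroup F →* GL (Fin 2) (FractionRing (𝓡.R ⧸ 𝔮.asIdeal)) :=
  (Matrix.GeneralLinearGroup.map
    (algebraMap (𝓡.R ⧸ 𝔮.asIdeal) (FractionRing (𝓡.R ⧸ 𝔮.asIdeal)))).comp (𝓡.modPrime 𝔮)

/-- Unfolding lemma for `fracModPrime`. [folklore] -/
@[simp] theorem fracModPrime_apply (𝔮 : PrimeSpectrum 𝓡.R) (γ : absoluteGaloisGroup F) :
    fracModPrime 𝓡 𝔮 γ =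
      Matrix.GeneralLinearGroup.map
        (algebraMap (𝓡.R ⧸ 𝔮.asIdeal) (FractionRing (𝓡.R ⧸ 𝔮.asIdeal))) (𝓡.modPrime 𝔮 γ) :=
  rfl

/-- The reducible locus of `Spec R_𝒟` is, by definition, the set of primes `𝔮` such that
`ρ_𝒟 mod 𝔮` is reducible over `Frac(R_𝒟/𝔮)`, i.e. such that `fracModPrime 𝓡 𝔮` is reducible.
[cite: SkinnerWiles1999, §2.2] -/
theorem mem_reducibleLocus_iff_isReducible_fracModPrime (𝔮 : PrimeSpectrum 𝓡.R) :
    𝔮 ∈ 𝓡.reducibleLocus ↔ Deformation.IsReducible (fracModPrime 𝓡 𝔮) :=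
  Iff.rfl

/-- **The ratio of the diagonal characters of `ρ_𝒟 mod 𝔮` has finite order**: for EVERY frame
`P ∈ GL₂(Frac(R_𝒟/𝔮))` in which `P⁻¹ (ρ_𝒟 mod 𝔮) P = (ψ₁ ∗; 0 ψ₂)` is upper triangular, the
character `ψ₁/ψ₂ = ψ₁ψ₂⁻¹ : Γ_F → Frac(R_𝒟/𝔮)ˣ` (`Deformation.diagChar`) is of finite order.
Vacuously true when `𝔮` is not in the reducible locus (no such frame).  This is the analogue,
for the ratio `ψ₁/ψ₂` of the diagonal characters of a reducible `ρ_𝒟 mod q`, of the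
finite-order conditions "its determinant has finite order" of Skinner–Wiles' Lemma 2.8 and
Lemma 2.9 (ii) cutting out the finite-order strata of the reducible locus; compare the
infinite-order condition on the local ratios `ψ₁⁽ⁱ⁾/ψ₂⁽ⁱ⁾` in their *nice* deformations (§2.3,
`NearlyOrdinaryDeformationRing.IsGoodPrime`). [folklore] -/
def HasFiniteOrderRatio (𝔮 : PrimeSpectrum 𝓡.R) : Prop :=
  ∀ (P : GL (Fin 2) (FractionRing (𝓡.R ⧸ 𝔮.asIdeal)))
    (hP : ∀ γ, (((MulAut.conj P⁻¹).toMonoidHom.comp (fracModPrime 𝓡 𝔮)) γ).val 1 0 = 0),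
    IsOfFinOrder (Deformation.diagChar _ hP 0 / Deformation.diagChar _ hP 1)

variable {𝓡} in
/-- Off the reducible locus `HasFiniteOrderRatio` holds vacuously: an upper-triangular frame of
`ρ_𝒟 mod 𝔮` over `Frac(R_𝒟/𝔮)` witnesses membership in the reducible locus. [folklore] -/
theorem hasFiniteOrderRatio_of_not_mem_reducibleLocus {𝔮 : PrimeSpectrum 𝓡.R}
    (h𝔮 : 𝔮 ∉ 𝓡.reducibleLocus) : HasFiniteOrderRatio 𝓡 𝔮 :=
  fun P hP => (h𝔮 ⟨P, fun γ => by simpa [MulAut.conj_apply] using hP γ⟩).elim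

/-- **The finite-order stratum of the reducible locus has dimension `≤ d`**: every prime `𝔮` of
the reducible locus of `Spec R_𝒟` such that `R_𝒟/𝔮` has characteristic `p` (i.e. `p ∈ 𝔮`) and
the ratio of the diagonal characters of `ρ_𝒟 mod 𝔮` has finite order (`HasFiniteOrderRatio`)
satisfies `dim R_𝒟/𝔮 ≤ d` (Krull dimension, in `WithBot ℕ∞`).  The shape of Skinner–Wiles'
bounds for the universal reducible deformation ring and its finite-order strata (Lemma 2.7:
`dim R_𝒟^red ≤ 1 + 2δ_F + dim_k H_Σ(F, k)`; Lemma 2.8: "if `q ⊆ R_𝒟` is a prime containing `p`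
such that `ρ_𝒟 mod q` is reducible and its determinant has finite order, then
`dim R_𝒟/q ≤ δ_F + dim_k H_Σ(F, k)`"), with the bound `d` a parameter and the ratio in place of
the determinant. [folklore] -/
def ClosedPointStratumLE (d : WithBot ℕ∞) : Prop :=
  ∀ 𝔮 ∈ 𝓡.reducibleLocus, CharP (𝓡.R ⧸ 𝔮.asIdeal) p → HasFiniteOrderRatio 𝓡 𝔮 →
    ringKrullDim (𝓡.R ⧸ 𝔮.asIdeal) ≤ d

variable {𝓡}

/-- `ClosedPointStratumLE 𝓡 d` is monotone in the bound `d`. [folklore] -/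
theorem ClosedPointStratumLE.mono {d d' : WithBot ℕ∞} (hd : d ≤ d') (h : ClosedPointStratumLE 𝓡 d) :
    ClosedPointStratumLE 𝓡 d' :=
  fun 𝔮 h𝔮 hchar hfin => (h 𝔮 h𝔮 hchar hfin).trans hd

variable (𝓡)

/-- The bound `d = ⊤` is no condition. [folklore] -/
theorem closedPointStratumLE_top : ClosedPointStratumLE 𝓡 ⊤ :=
  fun _ _ _ _ => le_top

end Deformation

/-! ### Modelling data for a characteristic-zero representation -/

section Models

variable {F : Type u} [Field F] [NumberField F] {p : ℕ} [Fact p.Prime]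

/-- **Skinner–Wiles coefficient and deformation data.**  A coefficient ring `𝒪`: a complete
discrete valuation ring of characteristic `0` ("the ring of integers `𝒪` of a local field with
finite residue field `k`" — the intended `𝒪 = 𝒪_E`, `E/ℚ_p` finite); its residue field `k`,
finite of characteristic `p` (`algebraMap 𝒪 k` is onto by `𝒟.residueMap_surjective`); a nearly
ordinary residual datum `𝒟` over `(𝒪, k)` (level `𝒟.S = Σ ⊇ Σ_p`, residual representation
`ρ̄_𝒟 : Γ_F → GL₂(k)` unramified outside `Σ` and residual special lines at `v ∣ p` — together with
`𝒪` this is Skinner–Wiles' deformation datum `𝒟 = (𝒪, Σ, c, ℳ)` with `ℳ = ∅`, the class `c`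
being carried by `ρ̄_𝒟 = ρ_c`); a universal nearly ordinary deformation ring `𝓡 = (R_𝒟, ρ_𝒟)` of
`𝒟` (the interface `NearlyOrdinaryDeformationRing`, universe `0`); and a specialisation
`φ : R_𝒟 → ℚ̄_p` (a `ℚ̄_p`-point of `Spec R_𝒟`, at which a given representation is to be
modelled, see `ModelData.Models`). [cite: SkinnerWiles1999, §2.1] -/
structure ModelData (F : Type u) [Field F] [NumberField F] (p : ℕ) [Fact p.Prime] :
    Type (max 1 u) where
  /-- the coefficient ring `𝒪` -/
  𝒪 : Type
  [instCommRing : CommRing 𝒪]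
  [instIsDomain : IsDomain 𝒪]
  [instDVR : IsDiscreteValuationRing 𝒪]
  [instCharZero : CharZero 𝒪]
  [instComplete : IsAdicComplete (IsLocalRing.maximalIdeal 𝒪) 𝒪]
  /-- the residue field `k` of `𝒪` -/
  k : Type
  [instField : Field k]
  [instFinite : Finite k]
  [instCharP : CharP k p]
  [instAlgebra : Algebra 𝒪 k]
  /-- the residual datum over `(𝒪, k)` -/
  𝒟 : NearlyOrdinaryDatum F p 𝒪 k
  /-- a universal nearly ordinary deformation ring `(R_𝒟, ρ_𝒟)` of `𝒟` -/
  𝓡 : NearlyOrdinaryDeformationRing.{0} 𝒟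
  /-- the specialisation `R_𝒟 → ℚ̄_p` -/
  φ : 𝓡.R →+* PadicAlgCl p

attribute [instance] ModelData.instCommRing ModelData.instIsDomain ModelData.instDVR
  ModelData.instCharZero ModelData.instComplete ModelData.instField ModelData.instFinite
  ModelData.instCharP ModelData.instAlgebra

/-- **The base level** `Σ♯(ρ) = {v ∣ p} ∪ {v : ρ is ramified at v}` of a framed
`ρ : Γ_F → GL₂(ℚ̄_p)` (the prime `p` is read off the coefficient field `PadicAlgCl p`): the least
set of finite places that a level `Σ` must contain for `ρ` to be a deformation of type
`𝒟 = (𝒪, Σ, c, ∅)` (Skinner–Wiles §2.1: `Σ ⊇ Σ_p`, and deformations of type `𝒟` are "unramified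
outside of `Σ` and the places above `∞`").  Finite as soon as `ρ` is unramified almost
everywhere (`finite_baseLevel`). [folklore] -/
def baseLevel (ρ : FramedGaloisRep F (PadicAlgCl p) 2) : Set (HeightOneSpectrum (𝓞 F)) :=
  {v | (p : 𝓞 F) ∈ v.asIdeal} ∪ {v | ¬ ρ.IsUnramifiedAt v}

omit [NumberField F] in
/-- Membership in the base level, unfolded. [folklore] -/
@[simp] theorem mem_baseLevel_iff (ρ : FramedGaloisRep F (PadicAlgCl p) 2)
    (v : HeightOneSpectrum (𝓞 F)) :
    v ∈ baseLevel ρ ↔ (p : 𝓞 F) ∈ v.asIdeal ∨ ¬ ρ.IsUnramifiedAt v :=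
  Iff.rfl

omit [Fact p.Prime] in
/-- Only finitely many finite places of a number field lie above a nonzero natural number `p`
(the primes of `𝓞 F` dividing the nonzero ideal `(p)`). [folklore] -/
theorem finite_setOf_natCast_mem_asIdeal (hp : p ≠ 0) :
    {v : HeightOneSpectrum (𝓞 F) | (p : 𝓞 F) ∈ v.asIdeal}.Finite := by
  have hI : Ideal.span {(p : 𝓞 F)} ≠ ⊥ := by
    rw [Ne, Ideal.span_singleton_eq_bot]
    exact_mod_cast hp
  refine (Ideal.finite_factors hI).subset fun v hv => ?_
  simp only [Set.mem_setOf_eq] at hv ⊢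
  exact (Ideal.dvd_span_singleton).mpr hv

/-- The base level of an almost everywhere unramified `ρ` is finite. [folklore] -/
theorem finite_baseLevel (ρ : FramedGaloisRep F (PadicAlgCl p) 2)
    (hunr : ∀ᶠ v in Filter.cofinite, ρ.IsUnramifiedAt v) : (baseLevel ρ).Finite :=
  (finite_setOf_natCast_mem_asIdeal (Fact.out : p.Prime).ne_zero).union
    (Filter.eventually_cofinite.mp hunr)

/-- **`M` models `(ρ, ρ₀)` at level `S`.**  Here `ρ : Γ_F → GL₂(ℚ̄_p)` is framed and continuous,
`O` is a valuation subring of `ℚ̄_p` and `ρ₀ : Γ_F → GL₂(O)` (intended: an integral model of `ρ`,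
upper triangular modulo `𝔪_O` with diagonal `(χ_a, χ_b) mod 𝔪_O`).  The conditions:
* `residual_upper`: `ρ̄_𝒟 = (χ̄₁ ∗; 0 χ̄₂)` is upper triangular in the standard basis (the global
  stable line is `e₁`);
* `residual_diag`: along some embedding `ι : k → O/𝔪_O` of residue fields the ORDERED residual
  diagonal characters agree with those of `ρ₀`: `ι ∘ χ̄ᵢ = (ρ₀)ᵢᵢ mod 𝔪_O`, `i = 1, 2`;
* `hasScalarCentralizer`: `ρ̄_𝒟` has scalar centralizer (Mazur's representability hypothesis
  `NearlyOrdinaryDatum.HasScalarCentralizer`; for `χ̄₁ ≠ χ̄₂` this says the extension `∗` is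
  NON-SPLIT, Berger–Klosin 2013 Lemma 28);
* `isDistinguishedAt`: `𝒟` is distinguished at every `v ∣ p` (`χ̄₁|_{D_v} ≠ χ̄₂|_{D_v}`,
  Calegari–Mazur Def. 2.3, Skinner–Wiles' `χ|_{D_i} ≠ 1`);
* `oriented`: at every `v ∣ p` the residual special line `(𝒟.frame v) e₁` is NOT the global stable
  line `e₁` (`(frame v)₁₀ ≠ 0`); hence `ρ̄_𝒟|_{D_v} ≅ χ̄₁ ⊕ χ̄₂` splits with the special line the
  `χ̄₂`-eigenline, i.e. the nearly ordinary sub-character is residually the global QUOTIENT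
  character — Skinner–Wiles' orientation "`ρ|_{D_i} ≅ (ψ₁⁽ⁱ⁾ ∗; 0 ψ₂⁽ⁱ⁾)` with
  `ψ₁⁽ⁱ⁾ ≡ χ mod 𝔪_A`" for `ρ_c = (1 ∗; 0 χ)`, `c` admissible (split at every `v ∣ p`);
* `S_eq`: the level of `𝒟` is `S`;
* `realizes`: `GL₂(φ) ∘ ρ_𝒟` is conjugate to `ρ` by some `P ∈ GL₂(ℚ̄_p)` — "`ρ` is a deformation of
  type `𝒟`" (so `ker φ` is the prime of `R_𝒟` carrying `ρ`).
[cite: SkinnerWiles1999, §2.1] -/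
structure ModelData.Models (M : ModelData F p) {O : ValuationSubring (PadicAlgCl p)}
    (ρ : FramedGaloisRep F (PadicAlgCl p) 2) (ρ₀ : absoluteGaloisGroup F →* GL (Fin 2) O)
    (S : Set (HeightOneSpectrum (𝓞 F))) : Prop where
  residual_upper : ∀ g, (M.𝒟.residual g).val 1 0 = 0
  residual_diag : ∃ ι : M.k →+* IsLocalRing.ResidueField O,
    ∀ g (i : Fin 2), ι ((M.𝒟.residual g).val i i) = IsLocalRing.residue O ((ρ₀ g).val i i)
  hasScalarCentralizer : M.𝒟.HasScalarCentralizer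
  isDistinguishedAt : ∀ v : HeightOneSpectrum (𝓞 F), (p : 𝓞 F) ∈ v.asIdeal → M.𝒟.IsDistinguishedAt v
  oriented : ∀ v : HeightOneSpectrum (𝓞 F), (p : 𝓞 F) ∈ v.asIdeal → (M.𝒟.frame v).val 1 0 ≠ 0
  S_eq : M.𝒟.S = S
  realizes : ∃ P : GL (Fin 2) (PadicAlgCl p),
    ∀ g, Matrix.GeneralLinearGroup.map M.φ (M.𝓡.ρ g) = P⁻¹ * ρ g * P

namespace ModelData.Models

variable {M : ModelData F p} {O : ValuationSubring (PadicAlgCl p)}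
  {ρ : FramedGaloisRep F (PadicAlgCl p) 2} {ρ₀ : absoluteGaloisGroup F →* GL (Fin 2) O}
  {S : Set (HeightOneSpectrum (𝓞 F))}

/-- The level of a model is finite (it is the level `𝒟.S` of the residual datum). [folklore] -/
theorem finite (h : M.Models ρ ρ₀ S) : S.Finite :=
  h.S_eq ▸ M.𝒟.S_finite

/-- The level of a model contains every place above `p`. [folklore] -/
theorem mem_of_mem_asIdeal (h : M.Models ρ ρ₀ S) (v : HeightOneSpectrum (𝓞 F))
    (hv : (p : 𝓞 F) ∈ v.asIdeal) : v ∈ S :=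
  h.S_eq ▸ M.𝒟.mem_S_of_mem v hv

/-- The residual representation of a model is reducible (it is upper triangular in the standard
basis). [folklore] -/
theorem isReducible_residual (h : M.Models ρ ρ₀ S) : Deformation.IsReducible M.𝒟.residual :=
  ⟨1, fun g => by simpa using h.residual_upper g⟩

end ModelData.Models

/-- **The unique-admissible-extension regime** for the pair `(ρ, ρ₀)`: EVERY `M : ModelData F p`
modelling `(ρ, ρ₀)` at the base level `baseLevel ρ = {v ∣ p} ∪ ram(ρ)` has finite-order stratum
of its reducible locus of Krull dimension `≤ 2` (`ClosedPointStratumLE M.𝓡 2`).  Motivation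
(nothing of it is asserted): by Skinner–Wiles' explicit description of the universal reducible
deformation (§2.2, Lemmas 2.7–2.8) that stratum is governed by the number
`m = dim_k H_Σ(F, k(χ̄₁χ̄₂⁻¹))` of independent admissible residual extensions, and over an imaginary
quadratic `F` the bound `2` at the base level is meant to express `m = 1` — uniqueness of the
admissible residual extension with scalar centralizer, the situation of Berger–Klosin 2009, §3,
Thm. 7 and its corollary. [folklore] -/
def UniqueAdmissibleExtension {O : ValuationSubring (PadicAlgCl p)}
    (ρ : FramedGaloisRep F (PadicAlgCl p) 2) (ρ₀ : absoluteGaloisGroup F →* GL (Fin 2) O) : Prop :=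
  ∀ M : ModelData F p, M.Models ρ ρ₀ (baseLevel ρ) → ClosedPointStratumLE M.𝓡 2

/-- Unfolding lemma for `UniqueAdmissibleExtension`. [folklore] -/
theorem uniqueAdmissibleExtension_iff {O : ValuationSubring (PadicAlgCl p)}
    (ρ : FramedGaloisRep F (PadicAlgCl p) 2) (ρ₀ : absoluteGaloisGroup F →* GL (Fin 2) O) :
    UniqueAdmissibleExtension ρ ρ₀ ↔
      ∀ M : ModelData F p, M.Models ρ ρ₀ (baseLevel ρ) → ClosedPointStratumLE M.𝓡 2 :=
  Iff.rfl

/-- In the regime, every base-level model satisfies the dimension bound for every `d ≥ 2`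
(monotonicity). [folklore] -/
theorem UniqueAdmissibleExtension.closedPointStratumLE_of_le {O : ValuationSubring (PadicAlgCl p)}
    {ρ : FramedGaloisRep F (PadicAlgCl p) 2} {ρ₀ : absoluteGaloisGroup F →* GL (Fin 2) O}
    (h : UniqueAdmissibleExtension ρ ρ₀) {d : WithBot ℕ∞} (hd : 2 ≤ d) (M : ModelData F p)
    (hM : M.Models ρ ρ₀ (baseLevel ρ)) : ClosedPointStratumLE M.𝓡 d :=
  (h M hM).mono hd

end Models

end Literature.NumberTheory.GaloisRepresentations

end
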